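import Mathlib.Combinatorics.SimpleGraph.Finite
import Mathlib.Combinatorics.SimpleGraph.Connectivity.Connected
import Mathlib.Order.Interval.Finset.Nat
import HarnessLib

/-!
# Non-backtracking walks through vertices of degree two; maximal chains

A finite simple graph `Z` is traversed by the deterministic NON-BACKTRACKING WALK on states
`(p, c)` ("previous vertex, current vertex"): the state MOVES when the current vertex `c` has
exactly one neighbour other than `p` (for `p ~ c`: when `deg c = 2`), to `(c, that neighbour)`,
and is FIXED otherwise (a dead end `deg c = 1`, or a branching vertex `deg c ≥ 3`). This is the
elementary device by which maximal paths of degree-`2` vertices ("chains", "corridors") of a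
graph are followed in linear time; it is the common combinatorial core of the polynomial-time
separation of the uncoloured Cai–Fürer–Immerman graphs (`CFIParitySeparator*.lean` under
`Literature/ModelTheory/FiniteModelTheory/`; Chen–Flum–Liu 2025, Thm. 8.1, whose proof
"propagates" the gadget information along exactly these chains), used there both on the CFI
graph and on its base graph.

Part 1 (the walk):
* `exits Z s`, `Moves Z s`, `trailStep Z s`, `trailRun Z k s = trailStep^[k] s`,
  `trailVert Z s k` (the vertex sequence `x₀ = p, x₁ = c, x₂, …`), `trailMoves Z N s` (number of
  moving steps among the first `N`);
* one-step API (`trailStep_of_exits_eq`, `trailRun_of_not_moves`, `trailMoves_eq_of_stop`),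
  the adjacency invariant, `moves_iff_degree_eq_two`, the shape of the run while it moves
  (`trailRun_eq`, `neighborFinset_trailVert`);
* the DISTINCTNESS lemma `trailVert_ne` (the degree-two vertices visited before the walk first
  returns to its start are pairwise distinct), whence TERMINATION from a start vertex of degree
  `≠ 2` within `|V|` steps (`exists_not_moves`) and the bound `trailVert_injOn`.

Part 2 (maximal chains from a START `IsTrailStart`: an adjacent state whose first vertex does
not have degree two):
* `trailLen Z s` (number of moves before the stop, `< |V|`), `trailEnd Z s` (the vertex where it
  stops: of degree `≠ 2`), the explicit shape `x₀, x₁, …, x_L, x_{L+1}` with `x₁, …, x_L` of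
  degree two and pairwise distinct, and the edge set `trailEdges Z s`;
* REVERSAL `trailRev Z s = (x_{L+1}, x_L)`: again a start, with the same length, the reversed
  vertex sequence and the same edges, and `trailRev (trailRev s) = s ≠ trailRev s`;
* DETERMINISM: two maximal chains sharing an edge are equal or reverse to each other
  (`IsTrailStart.eq_or_eq_rev_of_mem_trailEdges`);
* COVERAGE: in a preconnected graph having a start, every vertex lies on, and every edge belongs
  to, some maximal chain (`exists_isTrailStart_trailVert_eq`, `exists_isTrailStart_mem_trailEdges`);
* the TWO-REGULAR case (no start exists): the walk from any adjacent state is periodic with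
  period `|V|` and visits every vertex (`trailRun_card_of_two_regular`,
  `exists_trailVert_eq_of_two_regular`), for `Z` preconnected with all degrees two.

All statements are [folklore] (maximal paths through vertices of degree two; e.g. the
suppression of degree-two vertices in R. Diestel, *Graph Theory*, 5th ed., §1.7, and the linear
time traversal of such paths, J. Kleinberg, É. Tardos, *Algorithm Design*, §3). Mathlib has
`SimpleGraph.Walk`, `SimpleGraph.Path`, `SimpleGraph.degree` but no deterministic traversal of
degree-two chains (searched: `degree_eq_two`, `IsPath`, `support`, `IsCycles`).
-/

namespace Literature.Combinatorics.SimpleGraph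

open Finset Function _root_.SimpleGraph

section Walk

variable {V : Type*} [Fintype V] [DecidableEq V] (Z : _root_.SimpleGraph V) [DecidableRel Z.Adj]

/-! ### States, exits, one step -/

/-- The EXITS of a state `(p, c)`: the neighbours of the current vertex `c` other than the
previous vertex `p`. [folklore] -/
def exits (s : V × V) : Finset V := (Z.neighborFinset s.2).erase s.1

/-- A state MOVES when it has exactly one exit. [folklore] -/
def Moves (s : V × V) : Prop := (exits Z s).card = 1

/-- `Moves` is decidable. [folklore] -/
instance (s : V × V) : Decidable (Moves Z s) := inferInstanceAs (Decidable ((exits Z s).card = 1))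

/-- One step of the non-backtracking walk: move to the unique exit, or stay. [folklore] -/
noncomputable def trailStep (s : V × V) : V × V :=
  if h : (exits Z s).card = 1 then (s.2, (Finset.card_eq_one.mp h).choose) else s

/-- `k` steps of the non-backtracking walk. [folklore] -/
noncomputable def trailRun (k : ℕ) (s : V × V) : V × V := (trailStep Z)^[k] s

/-- The vertex sequence of the walk from `s = (x₀, x₁)`: `x₀`, `x₁`, and then the current
vertices of the run. [folklore] -/
noncomputable def trailVert (s : V × V) : ℕ → V
  | 0 => s.1
  | k + 1 => (trailRun Z k s).2

/-- The number of moving steps among the first `N` steps. [folklore] -/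
noncomputable def trailMoves (N : ℕ) (s : V × V) : ℕ :=
  ((range N).filter fun k => Moves Z (trailRun Z k s)).card

variable {Z}

/-- A state with the single exit `q` moves to `(c, q)`. [folklore] -/
theorem trailStep_of_exits_eq {s : V × V} {q : V} (h : exits Z s = {q}) :
    trailStep Z s = (s.2, q) := by
  have h1 : (exits Z s).card = 1 := by rw [h, card_singleton]
  have key : ∀ (t : Finset V) (hex : ∃ a, t = {a}), t = {q} → hex.choose = q := by
    intro t hex ht
    subst ht
    exact (singleton_inj.mp hex.choose_spec).symm
  unfold trailStep
  rw [dif_pos h1, key _ _ h]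

/-- A state that does not move is fixed. [folklore] -/
theorem trailStep_of_not_moves {s : V × V} (h : ¬ Moves Z s) : trailStep Z s = s := by
  unfold trailStep
  exact dif_neg h

/-- A moving state moves to its current vertex and an exit. [folklore] -/
theorem trailStep_of_moves {s : V × V} (h : Moves Z s) :
    (trailStep Z s).1 = s.2 ∧ (trailStep Z s).2 ∈ exits Z s := by
  obtain ⟨q, hq⟩ := Finset.card_eq_one.mp h
  rw [trailStep_of_exits_eq hq, hq]
  exact ⟨rfl, mem_singleton_self q⟩

/-- `trailRun 0 = id`. [folklore] -/
@[simp] theorem trailRun_zero (s : V × V) : trailRun Z 0 s = s := rfl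

/-- `trailRun (k+1) = trailStep ∘ trailRun k`. [folklore] -/
theorem trailRun_succ (k : ℕ) (s : V × V) : trailRun Z (k + 1) s = trailStep Z (trailRun Z k s) := by
  unfold trailRun
  rw [iterate_succ_apply']

/-- `trailRun (j + k) = trailRun j ∘ trailRun k`. [folklore] -/
theorem trailRun_add (j k : ℕ) (s : V × V) : trailRun Z (j + k) s = trailRun Z j (trailRun Z k s) := by
  unfold trailRun
  rw [iterate_add_apply]

/-- Once the walk stops it stays. [folklore] -/
theorem trailRun_of_not_moves {s : V × V} {k : ℕ} (h : ¬ Moves Z (trailRun Z k s)) {j : ℕ}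
    (hj : k ≤ j) : trailRun Z j s = trailRun Z k s := by
  obtain ⟨d, rfl⟩ := Nat.exists_eq_add_of_le hj
  clear hj
  induction d with
  | zero => rfl
  | succ d ih => rw [← Nat.add_assoc, trailRun_succ, ih, trailStep_of_not_moves h]

/-- If the walk moves at every step `< L` and not at step `L ≤ N`, it makes exactly `L` moves
among the first `N` steps. [folklore] -/
theorem trailMoves_eq_of_stop {s : V × V} {L N : ℕ} (hL : L ≤ N)
    (hmov : ∀ k < L, Moves Z (trailRun Z k s)) (hstop : ¬ Moves Z (trailRun Z L s)) :
    trailMoves Z N s = L := by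
  unfold trailMoves
  have : (range N).filter (fun k => Moves Z (trailRun Z k s)) = range L := by
    ext k
    simp only [mem_filter, mem_range]
    constructor
    · rintro ⟨-, hk⟩
      by_contra hkL
      rw [trailRun_of_not_moves hstop (not_lt.mp hkL)] at hk
      exact hstop hk
    · intro hk
      exact ⟨lt_of_lt_of_le hk hL, hmov k hk⟩
  rw [this, card_range]

/-- If the walk never stops before `N`, it makes `N` moves. [folklore] -/
theorem trailMoves_eq_self {s : V × V} {N : ℕ} (hmov : ∀ k < N, Moves Z (trailRun Z k s)) :
    trailMoves Z N s = N := by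
  unfold trailMoves
  have : (range N).filter (fun k => Moves Z (trailRun Z k s)) = range N := by
    ext k
    simp only [mem_filter, mem_range, and_iff_left_iff_imp]
    exact hmov k
  rw [this, card_range]

/-- After the stop the run is frozen at the stopping state. [folklore] -/
theorem trailRun_eq_of_stop {s : V × V} {L N : ℕ} (hL : L ≤ N) (hstop : ¬ Moves Z (trailRun Z L s)) :
    trailRun Z N s = trailRun Z L s :=
  trailRun_of_not_moves hstop hL

/-! ### Exits and degrees -/

omit [DecidableEq V] in
/-- The previous vertex of an adjacent state is a neighbour of the current one. [folklore] -/
theorem fst_mem_neighborFinset {s : V × V} (hs : Z.Adj s.1 s.2) : s.1 ∈ Z.neighborFinset s.2 := by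
  rw [mem_neighborFinset]
  exact hs.symm

/-- For an adjacent state, `|exits| = deg c - 1`. [folklore] -/
theorem card_exits {s : V × V} (hs : Z.Adj s.1 s.2) : (exits Z s).card = Z.degree s.2 - 1 := by
  unfold exits
  rw [card_erase_of_mem (fst_mem_neighborFinset hs), card_neighborFinset_eq_degree]

omit [DecidableEq V] in
/-- For an adjacent state, the current vertex has positive degree. [folklore] -/
theorem degree_pos_of_adj {s : V × V} (hs : Z.Adj s.1 s.2) : 0 < Z.degree s.2 :=
  (Z.degree_pos_iff_exists_adj s.2).mpr ⟨s.1, hs.symm⟩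

/-- **An adjacent state moves iff its current vertex has degree two.** [folklore] -/
theorem moves_iff_degree_eq_two {s : V × V} (hs : Z.Adj s.1 s.2) : Moves Z s ↔ Z.degree s.2 = 2 := by
  unfold Moves
  rw [card_exits hs]
  have := degree_pos_of_adj hs
  omega

/-- Membership in the exits. [folklore] -/
theorem mem_exits {s : V × V} {q : V} : q ∈ exits Z s ↔ Z.Adj s.2 q ∧ q ≠ s.1 := by
  unfold exits
  rw [mem_erase, mem_neighborFinset, and_comm]

/-- A state whose exits are exactly `{q}` (as a predicate). [folklore] -/
theorem exits_eq_singleton_iff {s : V × V} {q : V} :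
    exits Z s = {q} ↔ ∀ w, (Z.Adj s.2 w ∧ w ≠ s.1) ↔ w = q := by
  rw [Finset.ext_iff]
  simp only [mem_exits, mem_singleton]

/-- A state with two distinct exits does not move. [folklore] -/
theorem not_moves_of_two_exits {s : V × V} {q q' : V} (hq : q ∈ exits Z s) (hq' : q' ∈ exits Z s)
    (hne : q ≠ q') : ¬ Moves Z s := by
  intro h
  obtain ⟨a, ha⟩ := Finset.card_eq_one.mp h
  rw [ha, mem_singleton] at hq hq'
  exact hne (hq.trans hq'.symm)

/-- A state without exits does not move. [folklore] -/
theorem not_moves_of_no_exit {s : V × V} (h : ∀ w, Z.Adj s.2 w → w = s.1) : ¬ Moves Z s := by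
  intro hm
  obtain ⟨a, ha⟩ := Finset.card_eq_one.mp hm
  have : a ∈ exits Z s := by rw [ha]; exact mem_singleton_self a
  rw [mem_exits] at this
  exact this.2 (h a this.1)

/-! ### The adjacency invariant and the shape of the run -/

/-- **Adjacency is invariant**: along the walk from an adjacent state every state is adjacent.
[folklore] -/
theorem adj_trailRun {s : V × V} (hs : Z.Adj s.1 s.2) (k : ℕ) :
    Z.Adj (trailRun Z k s).1 (trailRun Z k s).2 := by
  induction k with
  | zero => exact hs
  | succ k ih =>
    rw [trailRun_succ]
    by_cases h : Moves Z (trailRun Z k s)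
    · obtain ⟨h1, h2⟩ := trailStep_of_moves h
      rw [mem_exits] at h2
      rw [h1]
      exact h2.1
    · rw [trailStep_of_not_moves h]
      exact ih

/-- The current vertex of the run is the next entry of the vertex sequence (by definition).
[folklore] -/
@[simp] theorem trailRun_snd (s : V × V) (k : ℕ) : (trailRun Z k s).2 = trailVert Z s (k + 1) := rfl

/-- `x₀ = p`. [folklore] -/
@[simp] theorem trailVert_zero (s : V × V) : trailVert Z s 0 = s.1 := rfl

/-- `x₁ = c`. [folklore] -/
@[simp] theorem trailVert_one (s : V × V) : trailVert Z s 1 = s.2 := rfl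

/-- After a moving step the previous vertex is the old current vertex. [folklore] -/
theorem trailRun_succ_fst {s : V × V} {k : ℕ} (h : Moves Z (trailRun Z k s)) :
    (trailRun Z (k + 1) s).1 = trailVert Z s (k + 1) := by
  rw [trailRun_succ, (trailStep_of_moves h).1, trailRun_snd]

/-- **Shape of the run**: if the walk moved at step `k - 1` (or `k = 0`), the `k`-th state is
`(x_k, x_{k+1})`. [folklore] -/
theorem trailRun_eq {s : V × V} {k : ℕ} (h : ∀ j, j + 1 = k → Moves Z (trailRun Z j s)) :
    trailRun Z k s = (trailVert Z s k, trailVert Z s (k + 1)) := by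
  rcases k with _ | k
  · rfl
  · exact Prod.ext (trailRun_succ_fst (h k rfl)) (trailRun_snd s (k + 1))

/-- The vertex after a moving step is an exit of that step. [folklore] -/
theorem trailVert_succ_succ_mem_exits {s : V × V} {k : ℕ} (h : Moves Z (trailRun Z k s)) :
    trailVert Z s (k + 2) ∈ exits Z (trailRun Z k s) := by
  have := (trailStep_of_moves h).2
  rwa [← trailRun_succ, trailRun_snd] at this

/-- Consecutive vertices of the sequence are adjacent as long as the walk moved. [folklore] -/
theorem adj_trailVert {s : V × V} (hs : Z.Adj s.1 s.2) {k : ℕ}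
    (h : ∀ j, j + 1 = k → Moves Z (trailRun Z j s)) :
    Z.Adj (trailVert Z s k) (trailVert Z s (k + 1)) := by
  have := adj_trailRun hs k
  rwa [trailRun_eq h] at this

/-- **No backtracking**: `x_{k+2} ≠ x_k` after a moving step from `(x_k, x_{k+1})`. [folklore] -/
theorem trailVert_succ_succ_ne {s : V × V} {k : ℕ} (hk : ∀ j, j + 1 = k → Moves Z (trailRun Z j s))
    (h : Moves Z (trailRun Z k s)) : trailVert Z s (k + 2) ≠ trailVert Z s k := by
  have hmem := trailVert_succ_succ_mem_exits h
  rw [mem_exits, trailRun_eq hk] at hmem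
  exact hmem.2

/-- **The exits of a moving state on the run are `{x_{k+2}}`.** [folklore] -/
theorem exits_trailRun_eq {s : V × V} {k : ℕ} (h : Moves Z (trailRun Z k s)) :
    exits Z (trailRun Z k s) = {trailVert Z s (k + 2)} := by
  obtain ⟨a, ha⟩ := Finset.card_eq_one.mp h
  have hmem := trailVert_succ_succ_mem_exits h
  rw [ha, mem_singleton] at hmem
  rw [ha, hmem]

/-- **The neighbourhood of a degree-two vertex on the walk**: if the walk moved at steps `k - 1`
(or `k = 0`) and `k`, then `N(x_{k+1}) = {x_k, x_{k+2}}`. [folklore] -/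
theorem neighborFinset_trailVert {s : V × V} (hs : Z.Adj s.1 s.2) {k : ℕ}
    (hk : ∀ j, j + 1 = k → Moves Z (trailRun Z j s)) (h : Moves Z (trailRun Z k s)) :
    Z.neighborFinset (trailVert Z s (k + 1)) = {trailVert Z s k, trailVert Z s (k + 2)} := by
  have hex := exits_trailRun_eq h
  unfold exits at hex
  rw [trailRun_eq hk] at hex
  dsimp only at hex
  have hmem : trailVert Z s k ∈ Z.neighborFinset (trailVert Z s (k + 1)) := by
    rw [mem_neighborFinset]
    exact (adj_trailVert hs hk).symm
  rw [← insert_erase hmem, hex]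

/-- Adjacency to a degree-two vertex of the walk means being one of its two walk-neighbours.
[folklore] -/
theorem adj_trailVert_iff {s : V × V} (hs : Z.Adj s.1 s.2) {k : ℕ}
    (hk : ∀ j, j + 1 = k → Moves Z (trailRun Z j s)) (h : Moves Z (trailRun Z k s)) {w : V} :
    Z.Adj (trailVert Z s (k + 1)) w ↔ w = trailVert Z s k ∨ w = trailVert Z s (k + 2) := by
  rw [← mem_neighborFinset, neighborFinset_trailVert hs hk h, mem_insert, mem_singleton]

/-! ### Distinctness of the visited degree-two vertices -/

/-- **Distinctness.** If the walk from the adjacent state `s = (x₀, x₁)` moves at every step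
`< m`, then for `j ≤ m + 1` such that the walk has not returned to `x₀` before time `j`, the
vertex `x_j` differs from all of `x₁, …, x_{j-1}`. (Proof: a first coincidence `x_i = x_j`
forces `x_{j-1} ∈ N(x_i) = {x_{i-1}, x_{i+1}}`, i.e. an earlier coincidence, a return to `x₀`,
or a backtracking step.) [folklore] -/
theorem trailVert_ne {s : V × V} (hs : Z.Adj s.1 s.2) {m : ℕ}
    (hmov : ∀ k < m, Moves Z (trailRun Z k s)) :
    ∀ j, j ≤ m + 1 → (∀ k, 1 ≤ k → k < j → trailVert Z s k ≠ trailVert Z s 0) →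
      ∀ i, 1 ≤ i → i < j → trailVert Z s i ≠ trailVert Z s j := by
  intro j
  induction j using Nat.strong_induction_on with
  | _ j ih =>
    intro hj hnr i hi hij heq
    -- write `j = j' + 1`, `i = i' + 1`; then `x_{j'} ~ x_{j'+1} = x_{i'+1}` and
    -- `N(x_{i'+1}) = {x_{i'}, x_{i'+2}}`
    obtain ⟨j, rfl⟩ : ∃ j', j = j' + 1 := ⟨j - 1, by omega⟩
    obtain ⟨i, rfl⟩ : ∃ i', i = i' + 1 := ⟨i - 1, by omega⟩
    have hmovj : ∀ j', j' + 1 = j → Moves Z (trailRun Z j' s) := fun j' hj' => hmov j' (by omega)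
    have hmovi : ∀ j', j' + 1 = i → Moves Z (trailRun Z j' s) := fun j' hj' => hmov j' (by omega)
    have hmi : Moves Z (trailRun Z i s) := hmov i (by omega)
    have hadj : Z.Adj (trailVert Z s j) (trailVert Z s (j + 1)) := adj_trailVert hs hmovj
    rw [← heq] at hadj
    rcases (adj_trailVert_iff hs hmovi hmi).mp hadj.symm with h1 | h2
    · -- `x_{j'} = x_{i'}`: a return to `x₀` (`i' = 0`) or an earlier coincidence
      rcases Nat.eq_zero_or_pos i with rfl | hi0
      · exact hnr j (by omega) (by omega) h1
      · exact ih j (by omega) (by omega) (fun k hk hkj => hnr k hk (by omega)) i hi0 (by omega) h1.symm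
    · -- `x_{j'} = x_{i'+2}`
      rcases Nat.lt_trichotomy (i + 2) j with hlt | heq' | hgt
      · exact ih j (by omega) (by omega) (fun k hk hkj => hnr k hk (by omega)) (i + 2) (by omega) hlt
          h2.symm
      · -- `j' = i' + 2`: then `x_{i'+3} = x_{i'+1}`, a backtracking step
        subst heq'
        exact trailVert_succ_succ_ne (k := i + 1) (fun j' hj' => hmov j' (by omega))
          (hmov (i + 1) (by omega)) heq.symm
      · -- `j' = i' + 1`: then `x_{i'+1} = x_{i'+2}` are adjacent and equal
        have hj' : j = i + 1 := by omega
        subst hj'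
        exact (adj_trailVert hs (k := i + 1) (fun j' hj' => hmov j' (by omega))).ne h2

/-- From a start vertex of degree `≠ 2` the walk does not return to it while it moves: the
visited current vertices have degree `2`. [folklore] -/
theorem trailVert_ne_zero_of_degree {s : V × V} (hs : Z.Adj s.1 s.2) (h0 : Z.degree s.1 ≠ 2) {m : ℕ}
    (hmov : ∀ k < m, Moves Z (trailRun Z k s)) {k : ℕ} (hk1 : 1 ≤ k) (hkm : k ≤ m) :
    trailVert Z s k ≠ trailVert Z s 0 := by
  obtain ⟨k, rfl⟩ : ∃ k', k = k' + 1 := ⟨k - 1, by omega⟩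
  have hm : Moves Z (trailRun Z k s) := hmov k (by omega)
  rw [moves_iff_degree_eq_two (adj_trailRun hs k), trailRun_snd] at hm
  intro heq
  rw [heq, trailVert_zero] at hm
  exact h0 hm

/-- The current vertices visited while moving have degree two. [folklore] -/
theorem degree_trailVert_eq_two {s : V × V} (hs : Z.Adj s.1 s.2) {k : ℕ} (h : Moves Z (trailRun Z k s)) :
    Z.degree (trailVert Z s (k + 1)) = 2 := by
  rwa [moves_iff_degree_eq_two (adj_trailRun hs k), trailRun_snd] at h

/-- **Injectivity**: from a start vertex of degree `≠ 2`, if the walk moves at every step `< m`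
then `x₁, …, x_{m+1}` are pairwise distinct. [folklore] -/
theorem trailVert_injOn {s : V × V} (hs : Z.Adj s.1 s.2) (h0 : Z.degree s.1 ≠ 2) {m : ℕ}
    (hmov : ∀ k < m, Moves Z (trailRun Z k s)) :
    Set.InjOn (trailVert Z s) (Set.Icc 1 (m + 1)) := by
  intro i hi j hj heq
  simp only [Set.mem_Icc] at hi hj
  by_contra hne
  have hnr : ∀ j', j' ≤ m + 1 → ∀ k, 1 ≤ k → k < j' → trailVert Z s k ≠ trailVert Z s 0 :=
    fun j' hj' k hk hkj => trailVert_ne_zero_of_degree hs h0 hmov hk (by omega)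
  rcases Nat.lt_or_gt_of_ne hne with hlt | hgt
  · exact trailVert_ne hs hmov j hj.2 (hnr j hj.2) i hi.1 hlt heq
  · exact trailVert_ne hs hmov i hi.2 (hnr i hi.2) j hj.1 hgt heq.symm

/-- **Termination**: from an adjacent state whose start vertex has degree `≠ 2` the walk stops
(reaches a non-moving state) in fewer than `|V|` steps. [folklore] -/
theorem exists_not_moves {s : V × V} (hs : Z.Adj s.1 s.2) (h0 : Z.degree s.1 ≠ 2) :
    ∃ k < Fintype.card V, ¬ Moves Z (trailRun Z k s) := by
  by_contra hcon
  push Not at hcon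
  -- `x₁, …, x_{|V|}` would be `|V|` distinct vertices of degree two, all different from `x₀`
  set m := Fintype.card V with hm
  have hmpos : 0 < m := Fintype.card_pos_iff.mpr ⟨s.1⟩
  have hmov : ∀ k < m - 1, Moves Z (trailRun Z k s) := fun k hk => hcon k (by omega)
  have hinj := trailVert_injOn hs h0 hmov
  have hm1 : m - 1 + 1 = m := by omega
  rw [hm1] at hinj
  have hsub : (Finset.Icc 1 m).image (trailVert Z s) ⊆ Finset.univ.erase s.1 := by
    intro x hx
    rw [mem_image] at hx
    obtain ⟨k, hk, rfl⟩ := hx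
    rw [Finset.mem_Icc] at hk
    rw [mem_erase]
    exact ⟨trailVert_ne_zero_of_degree hs h0 hcon hk.1 hk.2, mem_univ _⟩
  have hcard := card_le_card hsub
  rw [card_image_of_injOn (by rw [coe_Icc]; exact hinj), Nat.card_Icc, card_erase_of_mem (mem_univ _),
    card_univ] at hcard
  omega


end Walk

/-! ### Closed vertex sets in (pre)connected graphs -/

section Closed

variable {V : Type*} {Z : _root_.SimpleGraph V}

/-- A set of vertices closed under adjacency contains everything reachable from it. [folklore] -/
theorem mem_of_reachable_of_closed {U : Set V} (hU : ∀ u ∈ U, ∀ w, Z.Adj u w → w ∈ U)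
    {u v : V} (hu : u ∈ U) (h : Z.Reachable u v) : v ∈ U := by
  rw [reachable_iff_reflTransGen] at h
  induction h with
  | refl => exact hu
  | tail _ hab ih => exact hU _ ih _ hab

/-- In a preconnected graph a nonempty set of vertices closed under adjacency is everything.
[folklore] -/
theorem mem_of_preconnected_of_closed (hconn : Z.Preconnected) {U : Set V}
    (hU : ∀ u ∈ U, ∀ w, Z.Adj u w → w ∈ U) {u : V} (hu : u ∈ U) (v : V) : v ∈ U :=
  mem_of_reachable_of_closed hU hu (hconn u v)

/-- A two-valued potential that is constant along edges is constant along reachability.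
[folklore] -/
theorem apply_eq_of_reachable {β : Type*} (f : V → β) (hf : ∀ u w, Z.Adj u w → f u = f w)
    {u v : V} (h : Z.Reachable u v) : f u = f v := by
  have := mem_of_reachable_of_closed (U := {w | f u = f w}) (fun a ha w haw => by
    show f u = f w
    rw [Set.mem_setOf_eq] at ha
    rw [ha]
    exact hf a w haw) rfl h
  exact this

end Closed

section Trail

variable {V : Type*} [Fintype V] [DecidableEq V] (Z : _root_.SimpleGraph V) [DecidableRel Z.Adj]

/-! ### Length, end, edges and reversal of the maximal walk -/

/-- The LENGTH of the maximal walk from `s`: the number of moves within `|V|` steps. [folklore] -/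
noncomputable def trailLen (s : V × V) : ℕ := trailMoves Z (Fintype.card V) s

/-- The END of the maximal walk from `s`: the current vertex after `|V|` steps. [folklore] -/
noncomputable def trailEnd (s : V × V) : V := (trailRun Z (Fintype.card V) s).2

/-- The EDGES of the maximal walk from `s`: `x_k x_{k+1}` for `k ≤ trailLen`. [folklore] -/
noncomputable def trailEdges (s : V × V) : Finset (Sym2 V) :=
  (range (trailLen Z s + 1)).image fun k => s(trailVert Z s k, trailVert Z s (k + 1))

/-- The REVERSED start `(x_{L+1}, x_L)` of the maximal walk from `s`. [folklore] -/
noncomputable def trailRev (s : V × V) : V × V :=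
  (trailVert Z s (trailLen Z s + 1), trailVert Z s (trailLen Z s))

/-- A START: an adjacent state whose first vertex does not have degree two. [folklore] -/
structure IsTrailStart (s : V × V) : Prop where
  /-- The two vertices of the state are adjacent. -/
  adj : Z.Adj s.1 s.2
  /-- The first vertex does not have degree two. -/
  degree_ne : Z.degree s.1 ≠ 2

variable {Z}

/-- Membership in the edge set of the maximal walk. [folklore] -/
theorem mem_trailEdges {s : V × V} {e : Sym2 V} :
    e ∈ trailEdges Z s ↔ ∃ k ≤ trailLen Z s, e = s(trailVert Z s k, trailVert Z s (k + 1)) := by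
  unfold trailEdges
  rw [mem_image]
  simp only [mem_range, Nat.lt_succ_iff]
  constructor
  · rintro ⟨k, hk, rfl⟩
    exact ⟨k, hk, rfl⟩
  · rintro ⟨k, hk, rfl⟩
    exact ⟨k, hk, rfl⟩

/-- The first edge of the walk belongs to its edge set. [folklore] -/
theorem mem_trailEdges_zero (s : V × V) : s(s.1, s.2) ∈ trailEdges Z s :=
  mem_trailEdges.mpr ⟨0, Nat.zero_le _, rfl⟩

namespace IsTrailStart

variable {s : V × V}

/-- **The maximal walk from a start**: it moves at every step below `trailLen`, does not move
at step `trailLen`, and `trailLen < |V|`. [folklore] -/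
theorem spec (h : IsTrailStart Z s) :
    (∀ k < trailLen Z s, Moves Z (trailRun Z k s)) ∧ ¬ Moves Z (trailRun Z (trailLen Z s) s) ∧
      trailLen Z s < Fintype.card V := by
  have hex : ∃ k, ¬ Moves Z (trailRun Z k s) := by
    obtain ⟨k, -, hk⟩ := exists_not_moves h.adj h.degree_ne
    exact ⟨k, hk⟩
  have hstop : ¬ Moves Z (trailRun Z (Nat.find hex) s) := Nat.find_spec hex
  have hmov : ∀ k < Nat.find hex, Moves Z (trailRun Z k s) := fun k hk =>
    not_not.mp (Nat.find_min hex hk)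
  have hlt : Nat.find hex < Fintype.card V := by
    obtain ⟨k, hk, hk'⟩ := exists_not_moves h.adj h.degree_ne
    exact lt_of_le_of_lt (Nat.find_min' hex hk') hk
  have hLen : trailLen Z s = Nat.find hex := trailMoves_eq_of_stop hlt.le hmov hstop
  rw [hLen]
  exact ⟨hmov, hstop, hlt⟩

/-- The walk moves below `trailLen`. [folklore] -/
theorem moves (h : IsTrailStart Z s) {k : ℕ} (hk : k < trailLen Z s) : Moves Z (trailRun Z k s) :=
  h.spec.1 k hk

/-- The walk does not move at `trailLen`. [folklore] -/
theorem not_moves (h : IsTrailStart Z s) : ¬ Moves Z (trailRun Z (trailLen Z s) s) := h.spec.2.1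

/-- `trailLen < |V|`. [folklore] -/
theorem trailLen_lt (h : IsTrailStart Z s) : trailLen Z s < Fintype.card V := h.spec.2.2

/-- After `|V|` steps the walk sits at its stopping state. [folklore] -/
theorem trailRun_card (h : IsTrailStart Z s) :
    trailRun Z (Fintype.card V) s = trailRun Z (trailLen Z s) s :=
  trailRun_eq_of_stop h.trailLen_lt.le h.not_moves

/-- The states of the walk up to the stop: `(x_k, x_{k+1})`. [folklore] -/
theorem trailRun_eq (h : IsTrailStart Z s) {k : ℕ} (hk : k ≤ trailLen Z s) :
    trailRun Z k s = (trailVert Z s k, trailVert Z s (k + 1)) :=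
  Literature.Combinatorics.SimpleGraph.trailRun_eq fun j hj => h.moves (by omega)

/-- The end of the walk is `x_{L+1}`. [folklore] -/
theorem trailEnd_eq (h : IsTrailStart Z s) : trailEnd Z s = trailVert Z s (trailLen Z s + 1) := by
  unfold trailEnd
  rw [h.trailRun_card, trailRun_snd]

/-- Consecutive vertices `x_k ~ x_{k+1}` for `k ≤ L`. [folklore] -/
theorem adj_trailVert (h : IsTrailStart Z s) {k : ℕ} (hk : k ≤ trailLen Z s) :
    Z.Adj (trailVert Z s k) (trailVert Z s (k + 1)) :=
  Literature.Combinatorics.SimpleGraph.adj_trailVert h.adj fun j hj => h.moves (by omega)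

/-- The interior vertices `x_1, …, x_L` have degree two. [folklore] -/
theorem degree_trailVert (h : IsTrailStart Z s) {k : ℕ} (hk1 : 1 ≤ k) (hk : k ≤ trailLen Z s) :
    Z.degree (trailVert Z s k) = 2 := by
  obtain ⟨k, rfl⟩ : ∃ k', k = k' + 1 := ⟨k - 1, by omega⟩
  exact degree_trailVert_eq_two h.adj (h.moves (by omega))

/-- The end `x_{L+1}` does not have degree two. [folklore] -/
theorem degree_trailVert_succ_trailLen (h : IsTrailStart Z s) :
    Z.degree (trailVert Z s (trailLen Z s + 1)) ≠ 2 := by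
  intro h2
  have := h.not_moves
  rw [moves_iff_degree_eq_two (adj_trailRun h.adj _), trailRun_snd] at this
  exact this h2

/-- The end does not have degree two. [folklore] -/
theorem degree_trailEnd (h : IsTrailStart Z s) : Z.degree (trailEnd Z s) ≠ 2 := by
  rw [h.trailEnd_eq]
  exact h.degree_trailVert_succ_trailLen

/-- The neighbourhood of an interior vertex: `N(x_k) = {x_{k-1}, x_{k+1}}`. [folklore] -/
theorem neighborFinset_trailVert (h : IsTrailStart Z s) {k : ℕ} (hk1 : 1 ≤ k) (hk : k ≤ trailLen Z s) :
    Z.neighborFinset (trailVert Z s k) = {trailVert Z s (k - 1), trailVert Z s (k + 1)} := by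
  obtain ⟨k, rfl⟩ : ∃ k', k = k' + 1 := ⟨k - 1, by omega⟩
  rw [Nat.add_sub_cancel]
  exact Literature.Combinatorics.SimpleGraph.neighborFinset_trailVert h.adj
    (fun j hj => h.moves (by omega)) (h.moves (by omega))

/-- Adjacency to an interior vertex. [folklore] -/
theorem adj_trailVert_iff (h : IsTrailStart Z s) {k : ℕ} (hk1 : 1 ≤ k) (hk : k ≤ trailLen Z s)
    {w : V} : Z.Adj (trailVert Z s k) w ↔ w = trailVert Z s (k - 1) ∨ w = trailVert Z s (k + 1) := by
  rw [← mem_neighborFinset, h.neighborFinset_trailVert hk1 hk, mem_insert, mem_singleton]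

/-- No backtracking at interior vertices: `x_{k+1} ≠ x_{k-1}`. [folklore] -/
theorem trailVert_succ_ne_pred (h : IsTrailStart Z s) {k : ℕ} (hk1 : 1 ≤ k) (hk : k ≤ trailLen Z s) :
    trailVert Z s (k + 1) ≠ trailVert Z s (k - 1) := by
  obtain ⟨k, rfl⟩ : ∃ k', k = k' + 1 := ⟨k - 1, by omega⟩
  rw [Nat.add_sub_cancel]
  exact trailVert_succ_succ_ne (fun j hj => h.moves (by omega)) (h.moves (by omega))

/-- `x_1, …, x_{L+1}` are pairwise distinct. [folklore] -/
theorem trailVert_injOn (h : IsTrailStart Z s) :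
    Set.InjOn (trailVert Z s) (Set.Icc 1 (trailLen Z s + 1)) :=
  Literature.Combinatorics.SimpleGraph.trailVert_injOn h.adj h.degree_ne fun _ hk => h.moves hk

/-- The interior vertices differ from the start vertex. [folklore] -/
theorem trailVert_ne_zero (h : IsTrailStart Z s) {k : ℕ} (hk1 : 1 ≤ k) (hk : k ≤ trailLen Z s) :
    trailVert Z s k ≠ trailVert Z s 0 :=
  trailVert_ne_zero_of_degree h.adj h.degree_ne (fun _ hk => h.moves hk) hk1 hk

/-! ### Reversal -/

/-- The exits of the reversed interior state `(x_{j+1}, x_j)` are `{x_{j-1}}`. [folklore] -/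
theorem exits_rev_state (h : IsTrailStart Z s) {j : ℕ} (hj1 : 1 ≤ j) (hj : j ≤ trailLen Z s) :
    exits Z (trailVert Z s (j + 1), trailVert Z s j) = {trailVert Z s (j - 1)} := by
  have hne := h.trailVert_succ_ne_pred hj1 hj
  unfold exits
  dsimp only
  rw [h.neighborFinset_trailVert hj1 hj]
  ext w
  simp only [mem_erase, mem_insert, mem_singleton]
  constructor
  · rintro ⟨hw, h1 | h2⟩
    · exact h1
    · exact absurd h2 hw
  · intro hw
    subst hw
    exact ⟨hne.symm, Or.inl rfl⟩

/-- The reversed start is a start. [folklore] -/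
theorem rev (h : IsTrailStart Z s) : IsTrailStart Z (trailRev Z s) :=
  ⟨(h.adj_trailVert le_rfl).symm, h.degree_trailVert_succ_trailLen⟩

/-- **The reversed walk retraces the walk**: its `k`-th state is `(x_{L+1-k}, x_{L-k})`.
[folklore] -/
theorem trailRun_rev (h : IsTrailStart Z s) :
    ∀ {k : ℕ}, k ≤ trailLen Z s →
      trailRun Z k (trailRev Z s) = (trailVert Z s (trailLen Z s + 1 - k), trailVert Z s (trailLen Z s - k))
  | 0, _ => rfl
  | k + 1, hk => by
    rw [trailRun_succ, trailRun_rev h (Nat.le_of_succ_le hk)]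
    have e1 : trailLen Z s + 1 - k = trailLen Z s - k + 1 := by omega
    have e2 : trailLen Z s - (k + 1) = trailLen Z s - k - 1 := by omega
    have e3 : trailLen Z s + 1 - (k + 1) = trailLen Z s - k := by omega
    rw [e1, e2, e3]
    exact trailStep_of_exits_eq (h.exits_rev_state (by omega) (by omega))

/-- The reversed walk moves below `trailLen`. [folklore] -/
theorem moves_rev (h : IsTrailStart Z s) {k : ℕ} (hk : k < trailLen Z s) :
    Moves Z (trailRun Z k (trailRev Z s)) := by
  rw [h.trailRun_rev hk.le]
  have e1 : trailLen Z s + 1 - k = trailLen Z s - k + 1 := by omega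
  unfold Moves
  rw [e1, h.exits_rev_state (by omega) (by omega), card_singleton]

/-- The reversed walk stops at `trailLen` (it has reached `x₀`). [folklore] -/
theorem not_moves_rev (h : IsTrailStart Z s) : ¬ Moves Z (trailRun Z (trailLen Z s) (trailRev Z s)) := by
  rw [h.trailRun_rev le_rfl, Nat.sub_self, show trailLen Z s + 1 - trailLen Z s = 1 by omega]
  rw [moves_iff_degree_eq_two (s := (trailVert Z s 1, trailVert Z s 0)) (h.adj_trailVert (Nat.zero_le _)).symm]
  exact h.degree_ne

/-- The reversed walk has the same length. [folklore] -/
theorem trailLen_rev (h : IsTrailStart Z s) : trailLen Z (trailRev Z s) = trailLen Z s :=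
  trailMoves_eq_of_stop h.trailLen_lt.le (fun _ hk => h.moves_rev hk) h.not_moves_rev

/-- The reversed vertex sequence: `x'_k = x_{L+1-k}` for `k ≤ L + 1`. [folklore] -/
theorem trailVert_rev (h : IsTrailStart Z s) {k : ℕ} (hk : k ≤ trailLen Z s + 1) :
    trailVert Z (trailRev Z s) k = trailVert Z s (trailLen Z s + 1 - k) := by
  rcases k with _ | k
  · rfl
  · show (trailRun Z k (trailRev Z s)).2 = _
    rw [h.trailRun_rev (by omega)]
    show trailVert Z s (trailLen Z s - k) = _
    congr 1
    omega

/-- Reversing twice gives back the start. [folklore] -/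
theorem trailRev_rev (h : IsTrailStart Z s) : trailRev Z (trailRev Z s) = s := by
  show (trailVert Z (trailRev Z s) (trailLen Z (trailRev Z s) + 1),
    trailVert Z (trailRev Z s) (trailLen Z (trailRev Z s))) = s
  rw [h.trailLen_rev, h.trailVert_rev le_rfl, h.trailVert_rev (Nat.le_succ _), Nat.sub_self,
    show trailLen Z s + 1 - trailLen Z s = 1 by omega]
  rfl

/-- The end of the reversed walk is the start vertex. [folklore] -/
theorem trailEnd_rev (h : IsTrailStart Z s) : trailEnd Z (trailRev Z s) = s.1 := by
  rw [h.rev.trailEnd_eq, h.trailLen_rev, h.trailVert_rev le_rfl, Nat.sub_self]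
  rfl

/-- The reversed start differs from the start. [folklore] -/
theorem trailRev_ne (h : IsTrailStart Z s) : trailRev Z s ≠ s := by
  intro heq
  have h1 : trailVert Z s (trailLen Z s + 1) = trailVert Z s 0 := congrArg Prod.fst heq
  have h2 : trailVert Z s (trailLen Z s) = trailVert Z s 1 := congrArg Prod.snd heq
  rcases Nat.eq_zero_or_pos (trailLen Z s) with h0 | hpos
  · rw [h0] at h1
    exact (h.adj_trailVert (Nat.zero_le _)).ne h1.symm
  · have hL1 : trailLen Z s = 1 :=
      h.trailVert_injOn ⟨hpos, Nat.le_succ _⟩ ⟨le_rfl, by omega⟩ h2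
    have := h.trailVert_succ_ne_pred (k := 1) le_rfl (by omega)
    rw [hL1] at h1
    exact this h1

/-- The reversed walk has the same edges. [folklore] -/
theorem trailEdges_rev (h : IsTrailStart Z s) : trailEdges Z (trailRev Z s) = trailEdges Z s := by
  ext e
  rw [mem_trailEdges, mem_trailEdges, h.trailLen_rev]
  constructor
  · rintro ⟨k, hk, rfl⟩
    refine ⟨trailLen Z s - k, by omega, ?_⟩
    rw [h.trailVert_rev (by omega), h.trailVert_rev (by omega), Sym2.eq_swap]
    have e1 : trailLen Z s + 1 - (k + 1) = trailLen Z s - k := by omega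
    have e2 : trailLen Z s + 1 - k = trailLen Z s - k + 1 := by omega
    rw [e1, e2]
  · rintro ⟨k, hk, rfl⟩
    refine ⟨trailLen Z s - k, by omega, ?_⟩
    rw [h.trailVert_rev (by omega), h.trailVert_rev (by omega), Sym2.eq_swap]
    have e1 : trailLen Z s + 1 - (trailLen Z s - k) = k + 1 := by omega
    have e2 : trailLen Z s + 1 - (trailLen Z s - k + 1) = k := by omega
    rw [e1, e2]

/-! ### Determinism: chains sharing an edge coincide up to reversal -/

omit [Fintype V] [DecidableRel Z.Adj] in
/-- The elementary extraction used below: a member of `{a, q}` other than `q` is `a`. [folklore] -/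
theorem eq_of_mem_pair {a q b : V} (hb : b ∈ ({a, q} : Finset V)) (hbq : b ≠ q) : b = a := by
  rw [mem_insert, mem_singleton] at hb
  rcases hb with h | h
  · exact h
  · exact absurd h hbq

/-- **Forward determinism**: if the walks from two starts pass through the same ordered edge
`(x_i, x_{i+1}) = (x'_j, x'_{j+1})`, the starts (and the indices) are equal. [folklore] -/
theorem eq_of_trailVert_eq {s' : V × V} (h : IsTrailStart Z s) (h' : IsTrailStart Z s') :
    ∀ {i j : ℕ}, i ≤ trailLen Z s → j ≤ trailLen Z s' →
      trailVert Z s i = trailVert Z s' j → trailVert Z s (i + 1) = trailVert Z s' (j + 1) →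
        s = s' ∧ i = j
  | 0, j, _, hj, h1, h2 => by
    rcases Nat.eq_zero_or_pos j with rfl | hjpos
    · refine ⟨Prod.ext h1 h2, rfl⟩
    · exact absurd (h'.degree_trailVert hjpos hj) (by rw [← h1]; exact h.degree_ne)
  | i + 1, j, hi, hj, h1, h2 => by
    rcases Nat.eq_zero_or_pos j with rfl | hjpos
    · exact absurd (h.degree_trailVert (Nat.succ_pos i) hi) (by rw [h1]; exact h'.degree_ne)
    · obtain ⟨j, rfl⟩ : ∃ j', j = j' + 1 := ⟨j - 1, by omega⟩
      -- `N(x_{i+1}) = {x_i, x_{i+2}} = N(x'_{j+1}) = {x'_j, x'_{j+2}}` and `x_{i+2} = x'_{j+2}`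
      have hN := h.neighborFinset_trailVert (k := i + 1) (by omega) hi
      rw [h1, h'.neighborFinset_trailVert (k := j + 1) (by omega) hj] at hN
      simp only [Nat.add_sub_cancel] at hN
      have hmem : trailVert Z s i ∈ ({trailVert Z s' j, trailVert Z s' (j + 1 + 1)} : Finset V) := by
        rw [hN]; exact mem_insert_self _ _
      have hne : trailVert Z s i ≠ trailVert Z s' (j + 1 + 1) := by
        rw [← h2]
        have := h.trailVert_succ_ne_pred (k := i + 1) (by omega) hi
        rw [Nat.add_sub_cancel] at this
        exact this.symm
      have h0 : trailVert Z s i = trailVert Z s' j := eq_of_mem_pair hmem hne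
      obtain ⟨hs, hij⟩ := eq_of_trailVert_eq h h' (by omega) (by omega) h0 h1
      exact ⟨hs, by rw [hij]⟩

/-- **Backward determinism**: if the walk from `s` passes through an ordered edge that the walk
from `s'` passes in the opposite direction, then `s'` is the reversal of `s`. [folklore] -/
theorem eq_rev_of_trailVert_eq {s' : V × V} (h : IsTrailStart Z s) (h' : IsTrailStart Z s') :
    ∀ {i j : ℕ}, i ≤ trailLen Z s → j ≤ trailLen Z s' →
      trailVert Z s i = trailVert Z s' (j + 1) → trailVert Z s (i + 1) = trailVert Z s' j →
        s' = trailRev Z s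
  | 0, j, _, hj, h1, h2 => by
    -- `x'_{j+1} = x₀` has degree `≠ 2`, so `j = L'` and `trailRev s' = (x₀, x₁) = s`
    have hjL : j = trailLen Z s' := by
      by_contra hne
      have := h'.degree_trailVert (k := j + 1) (by omega) (by omega)
      rw [← h1] at this
      exact h.degree_ne this
    subst hjL
    have hrev : trailRev Z s' = s := Prod.ext h1.symm h2.symm
    rw [← hrev, h'.trailRev_rev]
  | i + 1, j, hi, hj, h1, h2 => by
    -- `x_{i+1}` has degree two, so `j + 1 ≤ L'`
    have hjlt : j + 1 ≤ trailLen Z s' := by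
      by_contra hne
      have hj' : j = trailLen Z s' := by omega
      subst hj'
      have := h.degree_trailVert (k := i + 1) (by omega) hi
      rw [h1] at this
      exact h'.degree_trailVert_succ_trailLen this
    -- `N(x_{i+1}) = {x_i, x_{i+2}} = N(x'_{j+1}) = {x'_j, x'_{j+2}}`, `x_{i+2} = x'_j`
    have hN := h.neighborFinset_trailVert (k := i + 1) (by omega) hi
    rw [h1, h'.neighborFinset_trailVert (k := j + 1) (by omega) hjlt] at hN
    simp only [Nat.add_sub_cancel] at hN
    have hmem : trailVert Z s i ∈ ({trailVert Z s' j, trailVert Z s' (j + 1 + 1)} : Finset V) := by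
      rw [hN]; exact mem_insert_self _ _
    have hne : trailVert Z s i ≠ trailVert Z s' j := by
      rw [← h2]
      have := h.trailVert_succ_ne_pred (k := i + 1) (by omega) hi
      rw [Nat.add_sub_cancel] at this
      exact this.symm
    have h0 : trailVert Z s i = trailVert Z s' (j + 1 + 1) := by
      rw [mem_insert, mem_singleton] at hmem
      rcases hmem with hm | hm
      · exact absurd hm hne
      · exact hm
    exact eq_rev_of_trailVert_eq h h' (by omega) hjlt h0 h1

/-- **Chains sharing an edge are equal or mutually reverse.** [folklore] -/
theorem eq_or_eq_rev_of_mem_trailEdges {s' : V × V} (h : IsTrailStart Z s) (h' : IsTrailStart Z s')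
    {e : Sym2 V} (he : e ∈ trailEdges Z s) (he' : e ∈ trailEdges Z s') :
    s' = s ∨ s' = trailRev Z s := by
  obtain ⟨i, hi, rfl⟩ := mem_trailEdges.mp he
  obtain ⟨j, hj, hij⟩ := mem_trailEdges.mp he'
  rw [Sym2.eq_iff] at hij
  rcases hij with ⟨h1, h2⟩ | ⟨h1, h2⟩
  · exact Or.inl (h.eq_of_trailVert_eq h' hi hj h1 h2).1.symm
  · exact Or.inr (h.eq_rev_of_trailVert_eq h' hi hj h1 h2)

end IsTrailStart

/-! ### Coverage -/

/-- **Every vertex lies on a maximal chain** (preconnected graph with at least one start).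
[folklore] -/
theorem exists_isTrailStart_trailVert_eq (hconn : Z.Preconnected) (hex : ∃ s : V × V, IsTrailStart Z s)
    (v : V) : ∃ s : V × V, IsTrailStart Z s ∧ ∃ k ≤ trailLen Z s + 1, trailVert Z s k = v := by
  obtain ⟨s₀, hs₀⟩ := hex
  refine mem_of_preconnected_of_closed hconn
    (U := {v | ∃ s : V × V, IsTrailStart Z s ∧ ∃ k ≤ trailLen Z s + 1, trailVert Z s k = v})
    ?_ (u := s₀.1) ⟨s₀, hs₀, 0, Nat.zero_le _, rfl⟩ v
  rintro u ⟨s, hs, k, hk, rfl⟩ w huw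
  by_cases hdeg : Z.degree (trailVert Z s k) = 2
  · -- an interior vertex: `w` is `x_{k-1}` or `x_{k+1}`
    have hk1 : 1 ≤ k := by
      rcases Nat.eq_zero_or_pos k with rfl | hk1
      · exact absurd hdeg hs.degree_ne
      · exact hk1
    have hkL : k ≤ trailLen Z s := by
      by_contra hne
      have : k = trailLen Z s + 1 := by omega
      subst this
      exact hs.degree_trailVert_succ_trailLen hdeg
    rcases (hs.adj_trailVert_iff hk1 hkL).mp huw with rfl | rfl
    · exact ⟨s, hs, k - 1, by omega, rfl⟩
    · exact ⟨s, hs, k + 1, by omega, rfl⟩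
  · -- a vertex of degree `≠ 2`: `(u, w)` is a start and `w` its second vertex
    exact ⟨(trailVert Z s k, w), ⟨huw, hdeg⟩, 1, by omega, rfl⟩

/-- **Every edge belongs to a maximal chain** (preconnected graph with at least one start).
[folklore] -/
theorem exists_isTrailStart_mem_trailEdges (hconn : Z.Preconnected) (hex : ∃ s : V × V, IsTrailStart Z s)
    {e : Sym2 V} (he : e ∈ Z.edgeSet) : ∃ s : V × V, IsTrailStart Z s ∧ e ∈ trailEdges Z s := by
  induction e using Sym2.ind with
  | _ a b =>
    rw [mem_edgeSet] at he
    obtain ⟨s, hs, k, hk, rfl⟩ := exists_isTrailStart_trailVert_eq hconn hex a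
    by_cases hdeg : Z.degree (trailVert Z s k) = 2
    · have hk1 : 1 ≤ k := by
        rcases Nat.eq_zero_or_pos k with rfl | hk1
        · exact absurd hdeg hs.degree_ne
        · exact hk1
      have hkL : k ≤ trailLen Z s := by
        by_contra hne
        have : k = trailLen Z s + 1 := by omega
        subst this
        exact hs.degree_trailVert_succ_trailLen hdeg
      rcases (hs.adj_trailVert_iff hk1 hkL).mp he with rfl | rfl
      · refine ⟨s, hs, mem_trailEdges.mpr ⟨k - 1, by omega, ?_⟩⟩
        rw [Sym2.eq_swap, Nat.sub_add_cancel hk1]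
      · exact ⟨s, hs, mem_trailEdges.mpr ⟨k, hkL, rfl⟩⟩
    · exact ⟨(trailVert Z s k, b), ⟨he, hdeg⟩, mem_trailEdges_zero _⟩

/-! ### Two-regular preconnected graphs: the walk is a Hamiltonian cycle -/

section TwoRegular

variable (hreg : ∀ v, Z.degree v = 2)
include hreg

/-- In a two-regular graph the walk always moves. [folklore] -/
theorem moves_of_two_regular {s : V × V} (hs : Z.Adj s.1 s.2) (k : ℕ) : Moves Z (trailRun Z k s) :=
  (moves_iff_degree_eq_two (adj_trailRun hs k)).mpr (hreg _)

/-- The states of the walk: `(x_k, x_{k+1})` for every `k`. [folklore] -/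
theorem trailRun_eq_of_two_regular {s : V × V} (hs : Z.Adj s.1 s.2) (k : ℕ) :
    trailRun Z k s = (trailVert Z s k, trailVert Z s (k + 1)) :=
  trailRun_eq fun j _ => moves_of_two_regular hreg hs j

/-- Neighbourhoods along the walk: `N(x_{k+1}) = {x_k, x_{k+2}}`. [folklore] -/
theorem neighborFinset_trailVert_of_two_regular {s : V × V} (hs : Z.Adj s.1 s.2) (k : ℕ) :
    Z.neighborFinset (trailVert Z s (k + 1)) = {trailVert Z s k, trailVert Z s (k + 2)} :=
  neighborFinset_trailVert hs (fun j _ => moves_of_two_regular hreg hs j) (moves_of_two_regular hreg hs k)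

/-- Consecutive vertices are adjacent. [folklore] -/
theorem adj_trailVert_of_two_regular {s : V × V} (hs : Z.Adj s.1 s.2) (k : ℕ) :
    Z.Adj (trailVert Z s k) (trailVert Z s (k + 1)) :=
  adj_trailVert hs fun j _ => moves_of_two_regular hreg hs j

/-- **The walk returns to its start** within `|V|` steps. [folklore] -/
theorem exists_return_of_two_regular {s : V × V} (hs : Z.Adj s.1 s.2) :
    ∃ R, 1 ≤ R ∧ R ≤ Fintype.card V ∧ trailVert Z s R = trailVert Z s 0 := by
  by_contra hcon
  push Not at hcon
  set n := Fintype.card V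
  have hmov : ∀ k < n, Moves Z (trailRun Z k s) := fun k _ => moves_of_two_regular hreg hs k
  have hnr : ∀ j, j ≤ n + 1 → ∀ k, 1 ≤ k → k < j → trailVert Z s k ≠ trailVert Z s 0 :=
    fun j hj k hk hkj => hcon k hk (by omega)
  have hinj : Set.InjOn (trailVert Z s) (Set.Icc 1 (n + 1)) := by
    intro i hi j hj heq
    simp only [Set.mem_Icc] at hi hj
    by_contra hne
    rcases Nat.lt_or_gt_of_ne hne with hlt | hgt
    · exact trailVert_ne hs hmov j hj.2 (hnr j hj.2) i hi.1 hlt heq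
    · exact trailVert_ne hs hmov i hi.2 (hnr i hi.2) j hj.1 hgt heq.symm
  have hcard := card_le_univ ((Finset.Icc 1 (n + 1)).image (trailVert Z s))
  rw [card_image_of_injOn (by rw [coe_Icc]; exact hinj), Nat.card_Icc] at hcard
  change n + 1 + 1 - 1 ≤ n at hcard
  omega

/-- The FIRST RETURN time of the walk in a two-regular graph. [folklore] -/
noncomputable def returnTime {s : V × V} (hs : Z.Adj s.1 s.2) : ℕ :=
  Nat.find (exists_return_of_two_regular hreg hs)

/-- The first return time `R` satisfies `1 ≤ R ≤ |V|` and `x_R = x₀`. [folklore] -/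
theorem returnTime_spec {s : V × V} (hs : Z.Adj s.1 s.2) :
    1 ≤ returnTime hreg hs ∧ returnTime hreg hs ≤ Fintype.card V ∧
      trailVert Z s (returnTime hreg hs) = trailVert Z s 0 :=
  Nat.find_spec (exists_return_of_two_regular hreg hs)

/-- No return before the first return time. [folklore] -/
theorem trailVert_ne_zero_of_lt_returnTime {s : V × V} (hs : Z.Adj s.1 s.2) {k : ℕ} (hk1 : 1 ≤ k)
    (hk : k < returnTime hreg hs) : trailVert Z s k ≠ trailVert Z s 0 := by
  intro heq
  have := Nat.find_min (exists_return_of_two_regular hreg hs) hk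
  exact this ⟨hk1, by have := (returnTime_spec hreg hs).2.1; omega, heq⟩

/-- The first return time is at least three (no loops, no backtracking). [folklore] -/
theorem three_le_returnTime {s : V × V} (hs : Z.Adj s.1 s.2) : 3 ≤ returnTime hreg hs := by
  obtain ⟨h1, -, hret⟩ := returnTime_spec hreg hs
  by_contra hlt
  rcases (show returnTime hreg hs = 1 ∨ returnTime hreg hs = 2 by omega) with h | h
  · rw [h] at hret
    exact hs.ne hret.symm
  · rw [h] at hret
    exact trailVert_succ_succ_ne (k := 0) (fun j hj => absurd hj (by omega))
      (moves_of_two_regular hreg hs 0) hret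

/-- `x₀, …, x_{R-1}` are pairwise distinct. [folklore] -/
theorem trailVert_injOn_of_two_regular {s : V × V} (hs : Z.Adj s.1 s.2) :
    Set.InjOn (trailVert Z s) (Set.Iio (returnTime hreg hs)) := by
  set R := returnTime hreg hs with hR
  have hmov : ∀ k < R, Moves Z (trailRun Z k s) := fun k _ => moves_of_two_regular hreg hs k
  have hnr : ∀ j, j ≤ R → ∀ k, 1 ≤ k → k < j → trailVert Z s k ≠ trailVert Z s 0 :=
    fun j hj k hk hkj => trailVert_ne_zero_of_lt_returnTime hreg hs hk (by omega)
  intro i hi j hj heq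
  simp only [Set.mem_Iio] at hi hj
  by_contra hne
  -- reduce to `1 ≤ i < j` (or symmetric), the case of index `0` being "no return before `R`"
  rcases Nat.lt_or_gt_of_ne hne with hlt | hgt
  · rcases Nat.eq_zero_or_pos i with rfl | hi1
    · exact hnr R le_rfl j (by omega) hj heq.symm
    · exact trailVert_ne hs hmov j (by omega) (hnr j (by omega)) i hi1 hlt heq
  · rcases Nat.eq_zero_or_pos j with rfl | hj1
    · exact hnr R le_rfl i (by omega) hi heq
    · exact trailVert_ne hs hmov i (by omega) (hnr i (by omega)) j hj1 hgt heq.symm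

/-- The neighbourhood of the start vertex: `N(x₀) = {x₁, x_{R-1}}`. [folklore] -/
theorem neighborFinset_zero_of_two_regular {s : V × V} (hs : Z.Adj s.1 s.2) :
    Z.neighborFinset (trailVert Z s 0) = {trailVert Z s 1, trailVert Z s (returnTime hreg hs - 1)} := by
  obtain ⟨h1, -, hret⟩ := returnTime_spec hreg hs
  have h3 := three_le_returnTime hreg hs
  -- both are neighbours, they are distinct, and the degree is two
  have ha : trailVert Z s 1 ∈ Z.neighborFinset (trailVert Z s 0) := by
    rw [mem_neighborFinset]; exact hs
  have hb : trailVert Z s (returnTime hreg hs - 1) ∈ Z.neighborFinset (trailVert Z s 0) := by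
    rw [mem_neighborFinset, ← hret]
    have := adj_trailVert_of_two_regular hreg hs (returnTime hreg hs - 1)
    rw [Nat.sub_add_cancel h1] at this
    exact this.symm
  have hne : trailVert Z s 1 ≠ trailVert Z s (returnTime hreg hs - 1) := fun heq =>
    absurd (trailVert_injOn_of_two_regular hreg hs (Set.mem_Iio.mpr (by omega))
      (Set.mem_Iio.mpr (by omega)) heq) (by omega)
  symm
  apply eq_of_subset_of_card_le
  · intro x hx
    rw [mem_insert, mem_singleton] at hx
    rcases hx with rfl | rfl
    · exact ha
    · exact hb
  · rw [card_neighborFinset_eq_degree, hreg, card_pair hne]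

/-- **Periodicity**: after the first return time the walk is back at its starting STATE.
[folklore] -/
theorem trailRun_returnTime {s : V × V} (hs : Z.Adj s.1 s.2) : trailRun Z (returnTime hreg hs) s = s := by
  obtain ⟨h1, -, hret⟩ := returnTime_spec hreg hs
  set R := returnTime hreg hs with hR
  obtain ⟨r, hr⟩ : ∃ r, R = r + 1 := ⟨R - 1, by omega⟩
  rw [hr, trailRun_succ, trailRun_eq_of_two_regular hreg hs r]
  -- the state `(x_r, x_{r+1}) = (x_{R-1}, x₀)` has the single exit `x₁`
  have hex : exits Z (trailVert Z s r, trailVert Z s (r + 1)) = {trailVert Z s 1} := by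
    unfold exits
    dsimp only
    rw [← hr, hret, neighborFinset_zero_of_two_regular hreg hs, ← hR, hr, Nat.add_sub_cancel]
    have h3 := three_le_returnTime hreg hs
    have hne : trailVert Z s 1 ≠ trailVert Z s r := fun heq =>
      absurd (trailVert_injOn_of_two_regular hreg hs (Set.mem_Iio.mpr (by omega))
        (Set.mem_Iio.mpr (by omega)) heq) (by omega)
    ext w
    simp only [mem_erase, mem_insert, mem_singleton]
    constructor
    · rintro ⟨hw, hw1 | hw2⟩
      · exact hw1
      · exact absurd hw2 hw
    · rintro rfl
      exact ⟨hne, Or.inl rfl⟩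
  rw [trailStep_of_exits_eq hex]
  show (trailVert Z s (r + 1), trailVert Z s 1) = s
  rw [← hr, hret]
  rfl

/-- The visited vertices `{x_k | k < R}` are all the vertices, so `R = |V|`. [folklore] -/
theorem returnTime_eq_card (hconn : Z.Preconnected) {s : V × V} (hs : Z.Adj s.1 s.2) :
    returnTime hreg hs = Fintype.card V := by
  set R := returnTime hreg hs with hR
  obtain ⟨h1, hRle, hret⟩ := returnTime_spec hreg hs
  have h3 := three_le_returnTime hreg hs
  -- the visited set is closed under adjacency
  have hall : ∀ v, v ∈ {v | ∃ k < R, trailVert Z s k = v} := by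
    refine mem_of_preconnected_of_closed hconn ?_ (u := trailVert Z s 0) ⟨0, by omega, rfl⟩
    rintro u ⟨k, hk, rfl⟩ w huw
    rcases Nat.eq_zero_or_pos k with rfl | hk1
    · rw [← mem_neighborFinset, neighborFinset_zero_of_two_regular hreg hs, mem_insert, mem_singleton] at huw
      rcases huw with rfl | rfl
      · exact ⟨1, by omega, rfl⟩
      · exact ⟨R - 1, by omega, rfl⟩
    · obtain ⟨k, rfl⟩ : ∃ k', k = k' + 1 := ⟨k - 1, by omega⟩
      rw [← mem_neighborFinset, neighborFinset_trailVert_of_two_regular hreg hs k, mem_insert,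
        mem_singleton] at huw
      rcases huw with rfl | rfl
      · exact ⟨k, by omega, rfl⟩
      · rcases Nat.lt_or_ge (k + 2) R with hlt | hge
        · exact ⟨k + 2, hlt, rfl⟩
        · have : k + 2 = R := by omega
          rw [this, hret]
          exact ⟨0, by omega, rfl⟩
  -- hence the image of `range R` is everything and `R = |V|`
  have himg : (range R).image (trailVert Z s) = univ := by
    apply eq_univ_of_forall
    intro v
    obtain ⟨k, hk, hkv⟩ := hall v
    exact mem_image.mpr ⟨k, mem_range.mpr hk, hkv⟩
  have hcard := congrArg Finset.card himg
  rw [card_image_of_injOn (by rw [coe_range]; exact trailVert_injOn_of_two_regular hreg hs), card_range,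
    card_univ] at hcard
  exact hcard

/-- **In a preconnected two-regular graph the walk has period `|V|`.** [folklore] -/
theorem trailRun_card_of_two_regular (hconn : Z.Preconnected) {s : V × V} (hs : Z.Adj s.1 s.2) :
    trailRun Z (Fintype.card V) s = s := by
  rw [← returnTime_eq_card hreg hconn hs]
  exact trailRun_returnTime hreg hs

/-- The vertex sequence has period `|V|`. [folklore] -/
theorem trailVert_add_card_of_two_regular (hconn : Z.Preconnected) {s : V × V} (hs : Z.Adj s.1 s.2)
    (k : ℕ) : trailVert Z s (k + Fintype.card V) = trailVert Z s k := by
  rcases k with _ | k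
  · have := congrArg Prod.fst (trailRun_card_of_two_regular hreg hconn hs)
    rw [trailRun_eq_of_two_regular hreg hs] at this
    simpa using this
  · rw [show k + 1 + Fintype.card V = k + Fintype.card V + 1 by omega]
    show (trailRun Z (k + Fintype.card V) s).2 = (trailRun Z k s).2
    rw [trailRun_add, trailRun_card_of_two_regular hreg hconn hs]

/-- **The walk visits every vertex** within `|V|` steps. [folklore] -/
theorem exists_trailVert_eq_of_two_regular (hconn : Z.Preconnected) {s : V × V} (hs : Z.Adj s.1 s.2)
    (v : V) : ∃ k < Fintype.card V, trailVert Z s k = v := by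
  have himg : v ∈ (range (returnTime hreg hs)).image (trailVert Z s) := by
    -- as in `returnTime_eq_card`: the image is everything (re-derive from the cardinality)
    have hsub : (range (returnTime hreg hs)).image (trailVert Z s) = univ := by
      apply eq_univ_of_card
      rw [card_image_of_injOn (by rw [coe_range]; exact trailVert_injOn_of_two_regular hreg hs), card_range,
        returnTime_eq_card hreg hconn hs]
    rw [hsub]
    exact mem_univ v
  obtain ⟨k, hk, hkv⟩ := mem_image.mp himg
  rw [mem_range, returnTime_eq_card hreg hconn hs] at hk
  exact ⟨k, hk, hkv⟩

/-- Injectivity of the vertex sequence on one period. [folklore] -/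
theorem trailVert_injOn_card_of_two_regular (hconn : Z.Preconnected) {s : V × V} (hs : Z.Adj s.1 s.2) :
    Set.InjOn (trailVert Z s) (Set.Iio (Fintype.card V)) := by
  rw [← returnTime_eq_card hreg hconn hs]
  exact trailVert_injOn_of_two_regular hreg hs

end TwoRegular

end Trail

end Literature.Combinatorics.SimpleGraph
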